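import Summits.Ventures.PercRepro.GenQTraceProfileE
import Summits.Ventures.PercRepro.GenQFlatLatticeB

/-!
# PercRepro — the trace profiles, part F: the coloop classes of a trace from the flats INSIDE it (night-4, gen 11)

The sharp form of part C's `t7_row`: a set `S ⊆ H ∩ G` of rank `q − 1` with `q − 1 − r` coloops has a cyclic part `Z` of
rank `r`, and its closure `F = cl Z` is a rank-`r` flat INSIDE `H` whose trace on `G` spans it (`lineOf_mem_flatsTr_inside`).
Fibring the lane's `card_Pc_sub_le` argument by these flats only,

`SPm_{s, j, q−1−r} ≤ Σ_{s′} C(s′, j − (q−1) + r)·C(s − s′, q−1−r)·NRin_{s, r, s′}`   (`t7_row_in`, `r ≤ q−1 < j ≤ s`)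

with `NRin` (`nrInM`, part E) the flats inside the traces — exactly the row (T7) of the two-level profile LP, capped
by (T8) = `sum_nrInM_le`.  Imports `GenQTraceProfileE`, `GenQFlatLatticeB`.
-/
namespace PercRepro.Night4

open Finset ThmH SixFour GenQ PerFlat Star

variable {α : Type*} [DecidableEq α] {M : Matroid α} [M.Finite]

/-- The flat `lineOf S = cl(S ∖ coloops S)` of a class-`(q − r)` set `S ⊆ H ∩ G` (`H` a flat) lies inside `H` and its
trace on `G` spans it. -/
theorem lineOf_mem_flatsTr_inside {G H S : Finset α} {q k r : ℕ} (hG : G ⊆ gr M) (hH : H ∈ flatsQ M q)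
    (hr : r ≤ q) (hS : S ∈ Pc M (H ∩ G) q k (q - r)) :
    lineOf M S ∈ (flatsTr M G r (lineOf M S ∩ G).card).filter (fun F : Finset α => F ⊆ H) := by
  have hHG : H ∩ G ⊆ gr M := Finset.inter_subset_right.trans hG
  have hF := lineOf_mem_flatsQ_of_Pc hHG hr hS
  have hS' := mem_Pc.1 hS
  have hSR := mem_Rq.1 hS'.1
  -- the cyclic part has rank `r`
  have hrk := eRk_sdiff_coloopsOf_add_mTr hHG hS'.1
  rw [hS'.2.2] at hrk
  have hZr : M.eRk ((S \ coloopsOf M S : Finset α) : Set α) = (r : ℕ∞) := by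
    obtain ⟨a, ha⟩ := exists_eRk_eq_nat (M := M) (S \ coloopsOf M S)
    rw [ha] at hrk ⊢
    have h1 : a + (q - r) = q := by exact_mod_cast hrk
    have : a = r := by omega
    rw [this]
  have hZH : S \ coloopsOf M S ⊆ H := Finset.sdiff_subset.trans (hSR.1.trans Finset.inter_subset_left)
  have hZG : S \ coloopsOf M S ⊆ G := Finset.sdiff_subset.trans (hSR.1.trans Finset.inter_subset_right)
  -- `lineOf S ⊆ H`
  have hFH : lineOf M S ⊆ H := by
    unfold lineOf
    rw [← Finset.coe_subset, coe_clF]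
    have h := M.closure_subset_closure (Finset.coe_subset.2 hZH)
    rw [(mem_flatsQ.1 hH).2.1.closure] at h
    exact h
  -- the trace of `lineOf S` contains the cyclic part, so it spans
  have hZF : S \ coloopsOf M S ⊆ lineOf M S ∩ G := by
    intro y hy
    rw [Finset.mem_inter]
    refine ⟨?_, hZG hy⟩
    unfold lineOf
    rw [mem_clF]
    refine M.subset_closure _ ?_ (Finset.mem_coe.2 hy)
    rw [← coe_gr M]
    exact Finset.coe_subset.2 (hZG.trans hG)
  rw [Finset.mem_filter, mem_flatsTr]
  refine ⟨⟨hF, rfl, le_antisymm ?_ ?_⟩, hFH⟩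
  · rw [← (mem_flatsQ.1 hF).2.2]
    exact M.eRk_mono (Finset.coe_subset.2 Finset.inter_subset_left)
  · rw [← hZr]
    exact M.eRk_mono (Finset.coe_subset.2 hZF)

/-- The class-`(q − r)` sets of a trace `H ∩ G`, counted by the flats inside `H` with spanning traces:
`#Pc (H ∩ G) q k (q − r) ≤ Σ_{s′} C(s′, d − k + r)·C(s − s′, q − r)·#{F ∈ flatsTr M G r s′ : F ⊆ H}`. -/
theorem card_Pc_trace_sub_le {G H : Finset α} {q s d k r : ℕ} (hG : G ⊆ gr M) (hH : H ∈ flatsQ M q)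
    (hHs : (H ∩ G).card = s) (hHr : M.eRk ((H ∩ G : Finset α) : Set α) = (q : ℕ∞)) (hr : r ≤ q)
    (hcard : s = q + d) (hk : k < d) :
    (Pc M (H ∩ G) q k (q - r)).card ≤
      ∑ s' ∈ Finset.range (G.card + 1), s'.choose (d - k + r) * ((s - s').choose (q - r) *
        ((flatsTr M G r s').filter (fun F : Finset α => F ⊆ H)).card) := by
  classical
  have hHG : H ∩ G ⊆ gr M := Finset.inter_subset_right.trans hG
  -- fibre by `lineOf` into the flats inside `H` with spanning traces, grouped by trace size
  have hmaps : ∀ S ∈ Pc M (H ∩ G) q k (q - r),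
      lineOf M S ∈ (Finset.range (G.card + 1)).biUnion
        (fun s' => (flatsTr M G r s').filter (fun F : Finset α => F ⊆ H)) := by
    intro S hS
    rw [Finset.mem_biUnion]
    exact ⟨(lineOf M S ∩ G).card, Finset.mem_range.2 (Nat.lt_succ_of_le
      (Finset.card_le_card Finset.inter_subset_right)), lineOf_mem_flatsTr_inside hG hH hr hS⟩
  rw [Finset.card_eq_sum_card_fiberwise (f := fun S : Finset α => lineOf M S)
    (t := (Finset.range (G.card + 1)).biUnion (fun s' => (flatsTr M G r s').filter (fun F : Finset α => F ⊆ H)))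
    (fun S hS => Finset.mem_coe.2 (hmaps S hS))]
  rw [Finset.sum_biUnion]
  · refine Finset.sum_le_sum (fun s' _ => ?_)
    rw [Finset.card_eq_sum_ones ((flatsTr M G r s').filter (fun F : Finset α => F ⊆ H)), Finset.mul_sum,
      Finset.mul_sum]
    refine Finset.sum_le_sum (fun F hF => ?_)
    rw [Finset.mem_filter] at hF
    have hFs : (F ∩ G).card = s' := (mem_flatsTr.1 hF.1).2.1
    have h1 := card_filter_lineOf_le_of_rank hHG hHr hr (d := d) (by rw [hHs, hcard]) hk (F := F)
    refine h1.trans ?_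
    -- `|F ∩ (H ∩ G)| = |F ∩ G|` (`F ⊆ H`) and `betaR ≤ C(|(H ∩ G) ∖ F|, q − r) = C(s − s′, q − r)`
    have hFHG : F ∩ (H ∩ G) = F ∩ G := by
      ext x
      simp only [Finset.mem_inter]
      constructor
      · rintro ⟨hxF, _, hxG⟩; exact ⟨hxF, hxG⟩
      · rintro ⟨hxF, hxG⟩; exact ⟨hxF, hF.2 hxF, hxG⟩
    rw [hFHG, hFs, mul_one]
    refine Nat.mul_le_mul_left _ ?_
    refine (betaR_le (H ∩ G) F q r).trans ?_
    rw [card_sdiff_eq_card_sub_card_inter, hFHG, hFs, hHs]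
  · intro s₁ _ s₂ _ hne
    rw [Function.onFun, Finset.disjoint_left]
    intro F h1 h2
    rw [Finset.mem_filter] at h1 h2
    exact hne ((mem_flatsTr.1 h1.1).2.1.symm.trans (mem_flatsTr.1 h2.1).2.1)

/-- **(T7), the inside form**: `SPm_{s, j, q−1−r} ≤ Σ_{s′} C(s′, j − (q−1) + r)·C(s − s′, q−1−r)·NRin_{s, r, s′}`
(`r ≤ q − 1 < j ≤ s`). -/
theorem t7_row_in {G : Finset α} (hG : G ⊆ gr M) {q s j r : ℕ} (hr : r ≤ q - 1) (hj : q - 1 < j)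
    (hjs : j ≤ s) :
    spSumM M G (q - 1) s j (q - 1 - r) ≤
      ∑ s' ∈ Finset.range (G.card + 1), s'.choose (j - (q - 1) + r) * ((s - s').choose (q - 1 - r) *
        nrInM M G q s r s') := by
  classical
  unfold spSumM nrInM
  have hswap : ∑ s' ∈ Finset.range (G.card + 1), s'.choose (j - (q - 1) + r) * ((s - s').choose (q - 1 - r) *
        ∑ H ∈ flatsTr M G (q - 1) s, ((flatsTr M G r s').filter (fun F : Finset α => F ⊆ H)).card)
      = ∑ H ∈ flatsTr M G (q - 1) s, ∑ s' ∈ Finset.range (G.card + 1),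
          s'.choose (j - (q - 1) + r) * ((s - s').choose (q - 1 - r) *
            ((flatsTr M G r s').filter (fun F : Finset α => F ⊆ H)).card) := by
    simp_rw [Finset.mul_sum]
    exact Finset.sum_comm
  rw [hswap]
  refine Finset.sum_le_sum (fun H hH => ?_)
  obtain ⟨hHG, hHr, hHs⟩ := trace_facts_of_mem_flatsTr hG hH
  rw [spFm_eq_card_Pc hHs hjs]
  have h := card_Pc_trace_sub_le (G := G) (H := H) (q := q - 1) (s := s) (d := s - (q - 1)) (k := s - j) (r := r)
    hG (mem_flatsTr.1 hH).1 hHs hHr hr (by omega) (by omega)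
  have hidx : s - (q - 1) - (s - j) + r = j - (q - 1) + r := by omega
  rw [hidx] at h
  exact h

end PercRepro.Night4
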